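import Literature.Topology.FourManifolds.FishtailTubeDZeroNorth
import Literature.Topology.FourManifolds.FishtailCharts
import Literature.Topology.FourManifolds.FishtailVertical
import Literature.Topology.FourManifolds.FishtailPathShell
import Literature.Topology.FourManifolds.FishtailLegTube
import Literature.Topology.FourManifolds.FishtailTubeA
import HarnessLib

/-!
# The tube over the collar annulus, the vertical segment, the path and the leg, in `X^σ`

Infrastructure for the explicit fishtail neighbourhood (R. Gompf, *More Cappell–Shaneson spheres
are standard*, Algebr. Geom. Topol. 10 (2010), proof of Thm 2.1 and Lemma 2.2; the named fact
`Literature.Topology.FourManifolds.gompf2010_framedTwist`). Above the part `D⁰` of Gompf's disc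
(the surgered section sphere minus a disc about the puncture `q₀`) the disc continues with the
collar annulus `A` (flat foot, quarter bend, wall: `FishtailTubeA*`, `FishtailPathShell`), the
vertical segment over the puncture (`FishtailVertical`), the planar path (`FishtailPathTube`,
`FishtailPathShell`) and the handle leg (`FishtailLegTube`), all in the honest second cylinder of
the mapping torus (`1/2 < t < 3/2`). This file reads the five pieces in `X^σ`
(`Literature.Topology.FourManifolds.pieceU5/U4/U3/U2/U1`: chart conversion `aConv` /
`physAssemble`, exponential coordinates `mtCoord`, old piece `toSurg`), proves that each is a
local diffeomorphism under the hypotheses of its real model (`isLocalDiffeomorphAt_pieceU*`), and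
records the four junction identities (`pieceU5_eq_pieceU4`, `pieceU4_eq_pieceU3`,
`pieceU3_eq_pieceU2`, `pieceU2_eq_pieceU1`). Everything is proved; no named facts.

## References

* R. E. Gompf, *More Cappell–Shaneson spheres are standard*, Algebr. Geom. Topol. 10 (2010)
  1665–1681, proof of Thm 2.1 and Lemma 2.2. [GompfAGT2010]
-/

noncomputable section

open scoped Real ContDiff Topology Manifold
open Set Function Filter Complex Metric

namespace Literature.Topology.FourManifolds

local notation "𝔼 " n:arg => EuclideanSpace ℝ (Fin n)

/-! ### Physical and chart points of the mapping torus -/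

section Points

variable {ε : ℝ} (hε : 0 < ε) (hε2 : ε ≤ 1 / 2) (nj : ℝ)

/-- **The `X^σ`-point with physical coordinates `(n, y, ℓ, t)`.** [folklore] -/
def physX (q : ℝ × ℝ × ℝ × ℝ) : (fishNu hε hε2).Surgered :=
  toSurg (fishNu hε hε2) (mtCoord tubeShearDiffeo (physAssemble q))

/-- **The `X^σ`-point with cap-chart offset coordinates `(P, y, ℓ)`** (`d = d₀ + P`). [folklore] -/
def dchartX (q : ℂ × ℝ × ℝ) : (fishNu hε hε2).Surgered :=
  toSurg (fishNu hε hε2) (mtCoord tubeShearDiffeo (aConv ε nj q))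

variable {nj}

/-- The `T³` point `expT v` is not `1` when its latitude `v₀ + v₂` satisfies `0 < |v₀ + v₂| < 2π`. [folklore] -/
theorem expT_ne_one_of_lat {v : 𝔼 3} (h0 : v 0 + v 2 ≠ 0) (h1 : |v 0 + v 2| < 2 * π) : expT v ≠ 1 := by
  intro h
  have h' : (expT v).1 * (expT v).2.2 = 1 := by rw [h]; exact mul_one 1
  have hprod : (expT v).1 * (expT v).2.2 = Circle.exp (v 0 + v 2) := by simp [expT, Circle.exp_add]
  rw [hprod, Circle.exp_eq_one] at h'
  obtain ⟨m, hm⟩ := h'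
  have hπ := Real.pi_pos
  obtain ⟨hl, hr⟩ := abs_lt.1 h1
  rcases lt_trichotomy m 0 with hneg | hzero | hpos
  · have : (m : ℝ) ≤ -1 := by exact_mod_cast Int.le_sub_one_iff.2 hneg
    nlinarith
  · rw [hzero] at hm; simp at hm; exact h0 hm
  · have : (1 : ℝ) ≤ m := by exact_mod_cast hpos
    nlinarith

/-- **The physical point map is a local diffeomorphism** at `(n, y, ℓ, t)` with `0 < t < 3/2` and
latitude `n ≠ 0`, `|n| < 2π`. [folklore] -/
theorem isLocalDiffeomorphAt_physX {q : ℝ × ℝ × ℝ × ℝ} (ht0 : 0 < q.2.2.2) (ht1 : q.2.2.2 < 3 / 2)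
    (hn0 : q.1 ≠ 0) (hn1 : |q.1| < 2 * π) :
    IsLocalDiffeomorphAt 𝓘(ℝ, ℝ × ℝ × ℝ × ℝ) 𝓘(ℝ, 𝔼 4) ∞ (physX hε hε2) q := by
  have h1 : IsLocalDiffeomorphAt 𝓘(ℝ, ℝ × ℝ × ℝ × ℝ) 𝓘(ℝ, (𝔼 3) × ℝ) ∞ physAssemble q := physAssemble.isLocalDiffeomorph q
  have h2 : IsLocalDiffeomorphAt 𝓘(ℝ, (𝔼 3) × ℝ) 𝓘(ℝ, 𝔼 4) ∞ (mtCoord tubeShearDiffeo) (physAssemble q) := by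
    have h := isLocalDiffeomorphAt_mtCoord (ψ := tubeShearDiffeo) (q := physAssemble q) (by simpa using ht0) (by simpa using ht1)
    rw [← modelWithCornersSelf_prod, chartedSpaceSelf_prod] at h
    exact h
  have hmem : mtCoord tubeShearDiffeo (physAssemble q) ∈ (fishNu hε hε2).complement := by
    rw [mtCoord]
    refine mtPt_mem_complement hε hε2 (expT_ne_one_of_lat ?_ ?_) (by simpa using ht0) (by simpa using ht1)
    · simpa using hn0
    · simpa using hn1
  exact (h1.comp (K := 𝓘(ℝ, 𝔼 4)) (P := MTorus tubeShearDiffeo) h2).comp (K := 𝓘(ℝ, 𝔼 4))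
    (P := (fishNu hε hε2).Surgered) (isLocalDiffeomorphAt_toSurg (ν := fishNu hε hε2) hmem)

/-- **The chart point map is a local diffeomorphism** at `(P, y, ℓ)` with `d₀ + P` in the slit plane
(and `ε ≤ 1/2`: the latitude `capN (d₀ + P) ∈ (-ε, 0)` is never `0 mod 2π`). [folklore] -/
theorem isLocalDiffeomorphAt_dchartX {q : ℂ × ℝ × ℝ} (hd : capD0 ε nj + q.1 ∈ slitPlane) :
    IsLocalDiffeomorphAt 𝓘(ℝ, ℂ × ℝ × ℝ) 𝓘(ℝ, 𝔼 4) ∞ (dchartX hε hε2 nj) q := by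
  have hs := capS_mem_of_mem_slitPlane hd
  have h1 := isLocalDiffeomorphAt_aConv (nj := nj) hε hd
  have h2 : IsLocalDiffeomorphAt 𝓘(ℝ, (𝔼 3) × ℝ) 𝓘(ℝ, 𝔼 4) ∞ (mtCoord tubeShearDiffeo) (aConv ε nj q) := by
    have h := isLocalDiffeomorphAt_mtCoord (ψ := tubeShearDiffeo) (q := aConv ε nj q)
      (by simp only [aConv]; linarith [hs.1]) (by simp only [aConv]; exact hs.2)
    rw [← modelWithCornersSelf_prod, chartedSpaceSelf_prod] at h
    exact h
  have hn : 0 < -capN ε (capD0 ε nj + q.1) := neg_capN_pos hε (slitPlane_ne_zero hd)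
  have hn' : -capN ε (capD0 ε nj + q.1) ≤ ε * ‖capD0 ε nj + q.1‖ := neg_capN_le hε _
  have hn'' : -capN ε (capD0 ε nj + q.1) < ε := by
    have := capLat_sq_lt hε ‖capD0 ε nj + q.1‖
    rw [capN] at hn ⊢
    nlinarith
  have hmem : mtCoord tubeShearDiffeo (aConv ε nj q) ∈ (fishNu hε hε2).complement := by
    rw [mtCoord]
    refine mtPt_mem_complement hε hε2 (expT_ne_one_of_lat ?_ ?_)
      (by simp only [aConv]; linarith [hs.1]) (by simp only [aConv]; exact hs.2)
    · simp [aConv]; linarith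
    · simp only [aConv, PiLp.toLp_apply, Matrix.cons_val_zero, Matrix.cons_val, sub_add_cancel]
      rw [abs_lt]; constructor <;> linarith [Real.pi_gt_three]
  exact (h1.comp (K := 𝓘(ℝ, 𝔼 4)) (P := MTorus tubeShearDiffeo) h2).comp (K := 𝓘(ℝ, 𝔼 4))
    (P := (fishNu hε hε2).Surgered) (isLocalDiffeomorphAt_toSurg (ν := fishNu hε hε2) hmem)

/-- A chart point `d₀ + P` with `‖P‖ < t_j` lies in the slit plane (its imaginary part is negative). [folklore] -/
theorem capD0_add_mem_slitPlane {P : ℂ} (hP : ‖P‖ < capTj ε nj) :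
    capD0 ε nj + P ∈ slitPlane := by
  rw [mem_slitPlane_iff]
  right
  have him : (capD0 ε nj + P).im = -capTj ε nj + P.im := by
    rw [add_im, capD0_im]
  rw [him]
  have : |P.im| ≤ ‖P‖ := abs_im_le_norm P
  have := (abs_le.1 this).2
  linarith

end Points

/-! ### The five pieces -/

section Pieces

variable {ε : ℝ} (hε : 0 < ε) (hε2 : ε ≤ 1 / 2) (nj ρA R₀ yh t₀ cL ρb : ℝ) (V : VertProfile) (μL : ℝ → ℝ)

/-- **U5: the tube about the collar annulus** (unified shell of radius `ρ_A` about the puncture):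
`(ψ, ϑ, a, b) ↦ [d₀ + X e^{iϑ}, y = Y, ℓ = ϑ - b]`, `(X, Y) = pathShell ρ_A (ψ, a)`. [folklore] -/
def pieceU5 (q : ℝ × ℝ × ℝ × ℝ) : (fishNu hε hε2).Surgered := dchartX hε hε2 nj (shellTubeMap (pathShell ρA) q)

/-- **U4: the tube about the wall above the foot** `(y, ϑ, a, b) ↦ [d₀ + P, y′, ℓ]`, `tubeUp`. [folklore] -/
def pieceU4 (q : ℝ × ℝ × ℝ × ℝ) : (fishNu hε hε2).Surgered := dchartX hε hε2 nj (tubeUpMap ρA q)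

/-- **U3: the tube about the vertical segment** `(y, ℓ, a, b) ↦ physical (n, y, ℓ, s)`, `vertMap`. [folklore] -/
def pieceU3 (q : ℝ × ℝ × ℝ × ℝ) : (fishNu hε hε2).Surgered :=
  physX hε hε2 ((vertCore ε nj V q.1 q.2.1 (q.2.2.1 + q.2.2.2 * I)).1, q.1, q.2.1,
    (vertCore ε nj V q.1 q.2.1 (q.2.2.1 + q.2.2.2 * I)).2)

/-- **U2: the tube about the planar path** `(ψ, ℓ, a, b) ↦ physical`, `pathTubeMap (pathShell R₀)`. [folklore] -/
def pieceU2 (q : ℝ × ℝ × ℝ × ℝ) : (fishNu hε hε2).Surgered := physX hε hε2 (pathTubeMap (pathShell R₀) nj yh t₀ q)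

/-- **U1: the tube about the handle leg** `(r, ϑ, a, b) ↦ physical`, `legTubeMap`. [folklore] -/
def pieceU1 (q : ℝ × ℝ × ℝ × ℝ) : (fishNu hε hε2).Surgered := physX hε hε2 (legTubeMap μL cL ρb nj yh q)

variable {nj ρA R₀ yh t₀ cL ρb V μL}

/-! #### Junction identities -/

/-- **U5 = U4 on the foot**: for `π/3 < ψ` with `y = ρ_A - ρ_A cos ψ / sin ψ ≤ 11 ρ_A/5`,
`pieceU5 (ψ, ϑ, a, b) = pieceU4 (y, ϑ, a, b)`. [folklore] -/
theorem pieceU5_eq_pieceU4 (hρ : 0 < ρA) {q : ℝ × ℝ × ℝ × ℝ} (hψ : π / 3 < q.1) (hy : footY ρA q.1 ≤ 11 * ρA / 5) :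
    pieceU5 hε hε2 nj ρA q = pieceU4 hε hε2 nj ρA (footY ρA q.1, q.2) := by
  simp only [pieceU5, pieceU4]
  congr 1
  rw [shellTubeMap, tubeUpMap, profTubeMap]
  simp only
  rw [tubeUp_of_le hρ hy, pathShell_eq_foot hρ (q := (q.1, q.2.2.1)) hψ]

/-- **U4 = U3 at the bottom of the vertical segment**: for `4 ρ_A ≤ y` and `m(y) = 1`, `θ(y) = 0`,
`σ₁(y) = σ₂(y) = 1`, `pieceU4 (y, ϑ, a, b) = pieceU3 (y, ϑ, a, b)`. [folklore] -/
theorem pieceU4_eq_pieceU3 (hρ : 0 < ρA) {q : ℝ × ℝ × ℝ × ℝ} (hy : 4 * ρA ≤ q.1) (hm : V.m q.1 = 1) (hθ : V.θ q.1 = 0)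
    (h1 : V.σ₁ q.1 = 1) (h2 : V.σ₂ q.1 = 1) :
    pieceU4 hε hε2 nj ρA q = pieceU3 hε hε2 nj V q := by
  simp only [pieceU4, pieceU3, dchartX, physX]
  congr 2
  rw [tubeUpMap, tubeUp_of_ge hρ (by linarith), uU_of_ge hρ hy, vertCore_of_bottom (V := V) hm hθ h1 h2]
  simp only [aConv, physAssemble_apply, zero_add]

/-- **U3 = U2 at the top of the vertical segment**: for `m(y) = 0`, `θ(y) = π/2`,
`σ₁(y) = 1/c_L`, `σ₂(y) = 2π t_j` (so that `J ∘ L = (re, -im)`), `t₀ = 3/4 - 2R₀`, and the path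
angle `ψ` with `y′ = R₀ - R₀ cos ψ / sin ψ`, `π/3 < ψ`, `2 R₀ ≤ y′`, `y = y_h - y′`:
`pieceU3 (y, ℓ, a, b) = pieceU2 (ψ, ℓ, a, b)`. [folklore] -/
theorem pieceU3_eq_pieceU2 (hε' : 0 < ε) (hnj : nj ^ 2 < ε ^ 2) (hnj0 : nj < 0) (hR : 0 < R₀) (ht₀ : t₀ = 3 / 4 - 2 * R₀)
    {κ : ℝ} (hκ : κ ≠ 0) {ψ ℓ a b : ℝ} (hψ : π / 3 < ψ) (hy' : 2 * R₀ ≤ footY R₀ ψ)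
    (hm : V.m (yh - footY R₀ ψ) = 0) (hθ : V.θ (yh - footY R₀ ψ) = π / 2)
    (h1 : V.σ₁ (yh - footY R₀ ψ) = 1 / (κ * capCL ε nj)) (h2 : V.σ₂ (yh - footY R₀ ψ) = 2 * π * capTj ε nj / κ) :
    pieceU3 hε hε2 nj V (yh - footY R₀ ψ, ℓ, κ * a, κ * b) = pieceU2 hε hε2 nj R₀ yh t₀ (ψ, ℓ, a, b) := by
  simp only [pieceU3, pieceU2]
  congr 1
  have hcL : capCL ε nj ≠ 0 := (capCL_pos (nj := nj) hε').ne'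
  have htj : capTj ε nj ≠ 0 := (capTj_pos hnj hnj0).ne'
  -- the top frame composed with `J` undoes the scale `κ`: `J (L (κ z)) = (re z, -im z)`
  have hJL : ∀ z : ℂ, capJL ε nj (V.frameL (yh - footY R₀ ψ) (κ * z)) = (z.re, -z.im) := by
    intro z
    rw [V.frameL_apply, hθ, h1, h2, capJL]
    simp only [ContinuousLinearMap.prod_apply, FunLike.coe_smul, Pi.smul_apply, imCLM_apply,
      reCLM_apply, smul_eq_mul, exp_mul_I]
    refine Prod.ext ?_ ?_
    · simp; field_simp
    · simp; field_simp
  obtain ⟨hre, him⟩ := re_im_rot ℓ a b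
  have hκz : ((κ * a : ℝ) : ℂ) + ((κ * b : ℝ) : ℂ) * I = κ * (a + b * I) := by push_cast; ring
  have hV : vertCore ε nj V (yh - footY R₀ ψ) ℓ ((κ * a : ℝ) + (κ * b : ℝ) * I) = (nj + (rotAB ℓ a b).2, 3 / 4 + (rotAB ℓ a b).1) := by
    rw [vertCore_of_top (V := V) hm, hκz, mul_assoc, hJL, mul_comm, hre, him, neg_neg, Prod.mk_add_mk]
  -- the path side: foot plateau
  have hP : pathTubeMap (pathShell R₀) nj yh t₀ (ψ, ℓ, a, b) =
      (nj + (rotAB ℓ a b).2, yh - footY R₀ ψ, ℓ, t₀ + (2 * R₀ + (rotAB ℓ a b).1)) := by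
    simp only [pathTubeMap]
    rw [pathShell_eq_foot hR (q := (ψ, (rotAB ℓ a b).1)) hψ]
    simp only [footPt_of_ge hR hy']
  have hL : ((vertCore ε nj V (yh - footY R₀ ψ) ℓ ((κ * a : ℝ) + (κ * b : ℝ) * I)).1, yh - footY R₀ ψ, ℓ,
      (vertCore ε nj V (yh - footY R₀ ψ) ℓ ((κ * a : ℝ) + (κ * b : ℝ) * I)).2) =
      (nj + (rotAB ℓ a b).2, yh - footY R₀ ψ, ℓ, t₀ + (2 * R₀ + (rotAB ℓ a b).1)) := by
    rw [hV, ht₀]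
    refine Prod.ext rfl (Prod.ext rfl (Prod.ext rfl ?_))
    simp only
    ring
  rw [hL, hP]

/-- **U2 = U1 on the flat leg**: with `t₀ = 3/4 - 2R₀`, on the flat plateau `3R₀ ≤ u₀ = 3R₀ - R₀ tan β`
(`β ≤ 0`, `β > -π/2`), `μ_L(r_L) = 0` at `r_L = (h cρ_b - 1/4 + R₀ - R₀ tan β)/h`:
`pieceU2 (β, ℓ, a, b) = pieceU1 (r_L, ℓ, a, b)`. [folklore] -/
theorem pieceU2_eq_pieceU1 (hR : 0 < R₀) (ht₀ : t₀ = 3 / 4 - 2 * R₀) {β ℓ a b : ℝ} (hβ0 : -(π / 2) < β) (hβ : β ≤ 0)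
    (hμ : μL ((bxH * (cL * ρb) - 1 / 4 + R₀ - R₀ * Real.tan β) / bxH) = 0) :
    pieceU2 hε hε2 nj R₀ yh t₀ (β, ℓ, a, b) =
      pieceU1 hε hε2 nj yh cL ρb μL ((bxH * (cL * ρb) - 1 / 4 + R₀ - R₀ * Real.tan β) / bxH, ℓ, a, b) := by
  simp only [pieceU2, pieceU1]
  congr 1
  have htan : Real.tan β ≤ 0 := by
    rw [Real.tan_eq_sin_div_cos]
    exact div_nonpos_of_nonpos_of_nonneg (Real.sin_nonpos_of_nonpos_of_neg_pi_le hβ (by linarith))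
      (Real.cos_nonneg_of_mem_Icc ⟨by linarith, by linarith [Real.pi_pos]⟩)
  have hflat : 3 * R₀ ≤ flatU R₀ β := by unfold flatU; nlinarith
  rw [legTubeMap_of_mu_zero (by exact hμ)]
  simp only [pathTubeMap]
  rw [pathShell_eq_flat hR (q := (β, (rotAB ℓ a b).1)) (by simp only; linarith [Real.pi_pos]),
    flatPt_of_ge hR hflat]
  simp only [flatU, ht₀]
  have hh : bxH ≠ 0 := bxH_pos.ne'
  refine Prod.ext rfl (Prod.ext rfl (Prod.ext rfl ?_))
  field_simp
  ring

/-! #### Local diffeomorphism of the pieces -/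

/-- The reordering `(y, ℓ, a, b) ↦ ((y, ℓ), a + bi)`, a diffeomorphism. [folklore] -/
def vertIn : (ℝ × ℝ × ℝ × ℝ) ≃ₘ⟮𝓘(ℝ, ℝ × ℝ × ℝ × ℝ), 𝓘(ℝ, (ℝ × ℝ) × ℂ)⟯ ((ℝ × ℝ) × ℂ) where
  toFun q := ((q.1, q.2.1), (q.2.2.1 : ℂ) + q.2.2.2 * I)
  invFun p := (p.1.1, p.1.2, p.2.re, p.2.im)
  left_inv q := by
    obtain ⟨y, ℓ, a, b⟩ := q
    simp
  right_inv p := by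
    obtain ⟨⟨y, ℓ⟩, w⟩ := p
    simp [Complex.re_add_im]
  contMDiff_toFun := contMDiff_iff_contDiff.2 ((contDiff_fst.prodMk (contDiff_fst.comp contDiff_snd)).prodMk
    ((ofRealCLM.contDiff.comp (contDiff_fst.comp (contDiff_snd.comp contDiff_snd))).add
      ((ofRealCLM.contDiff.comp (contDiff_snd.comp (contDiff_snd.comp contDiff_snd))).mul contDiff_const)))
  contMDiff_invFun := contMDiff_iff_contDiff.2 ((contDiff_fst.comp contDiff_fst).prodMk
    ((contDiff_snd.comp contDiff_fst).prodMk ((reCLM.contDiff.comp contDiff_snd).prodMk (imCLM.contDiff.comp contDiff_snd))))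

/-- The reordering `((y, ℓ), (n, s)) ↦ (n, y, ℓ, s)`, a diffeomorphism. [folklore] -/
def vertOut : ((ℝ × ℝ) × (ℝ × ℝ)) ≃ₘ⟮𝓘(ℝ, (ℝ × ℝ) × (ℝ × ℝ)), 𝓘(ℝ, ℝ × ℝ × ℝ × ℝ)⟯ (ℝ × ℝ × ℝ × ℝ) where
  toFun p := (p.2.1, p.1.1, p.1.2, p.2.2)
  invFun q := ((q.2.1, q.2.2.1), (q.1, q.2.2.2))
  left_inv _ := rfl
  right_inv _ := rfl
  contMDiff_toFun := contMDiff_iff_contDiff.2 ((contDiff_fst.comp contDiff_snd).prodMk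
    ((contDiff_fst.comp contDiff_fst).prodMk ((contDiff_snd.comp contDiff_fst).prodMk (contDiff_snd.comp contDiff_snd))))
  contMDiff_invFun := contMDiff_iff_contDiff.2 (((contDiff_fst.comp contDiff_snd).prodMk
    (contDiff_fst.comp (contDiff_snd.comp contDiff_snd))).prodMk
      (contDiff_fst.prodMk (contDiff_snd.comp (contDiff_snd.comp contDiff_snd))))

/-- The vertical piece factors as `physX ∘ vertOut ∘ vertMap ∘ vertIn`. [folklore] -/
theorem pieceU3_eq (q : ℝ × ℝ × ℝ × ℝ) :
    pieceU3 hε hε2 nj V q = physX hε hε2 (vertOut (vertMap ε nj V (vertIn q))) := rfl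

/-- **U3 is a local diffeomorphism** at `(y, ℓ, a, b)` with `‖a + bi‖ < r_sw / S` (switch radius),
the image base `s ∈ (0, 3/2)` and latitude `n ≠ 0`, `|n| < 2π`. [folklore] -/
theorem isLocalDiffeomorphAt_pieceU3 (hnj : nj ^ 2 < ε ^ 2) (hnj0 : nj < 0) {q : ℝ × ℝ × ℝ × ℝ}
    (hw : ‖((q.2.2.1 : ℂ) + q.2.2.2 * I)‖ < capSwitchRad hε hnj hnj0 / V.S)
    (hs0 : 0 < (vertCore ε nj V q.1 q.2.1 (q.2.2.1 + q.2.2.2 * I)).2)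
    (hs1 : (vertCore ε nj V q.1 q.2.1 (q.2.2.1 + q.2.2.2 * I)).2 < 3 / 2)
    (hn0 : (vertCore ε nj V q.1 q.2.1 (q.2.2.1 + q.2.2.2 * I)).1 ≠ 0)
    (hn1 : |(vertCore ε nj V q.1 q.2.1 (q.2.2.1 + q.2.2.2 * I)).1| < 2 * π) :
    IsLocalDiffeomorphAt 𝓘(ℝ, ℝ × ℝ × ℝ × ℝ) 𝓘(ℝ, 𝔼 4) ∞ (pieceU3 hε hε2 nj V) q := by
  have h1 : IsLocalDiffeomorphAt 𝓘(ℝ, ℝ × ℝ × ℝ × ℝ) 𝓘(ℝ, (ℝ × ℝ) × ℂ) ∞ vertIn q := vertIn.isLocalDiffeomorph q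
  have h2 := isLocalDiffeomorphAt_vertMap (V := V) hε hnj hnj0 (q := vertIn q) hw
  have h3 := vertOut.isLocalDiffeomorph (vertMap ε nj V (vertIn q))
  have h4 : IsLocalDiffeomorphAt 𝓘(ℝ, ℝ × ℝ × ℝ × ℝ) 𝓘(ℝ, 𝔼 4) ∞ (physX hε hε2) (vertOut (vertMap ε nj V (vertIn q))) :=
    isLocalDiffeomorphAt_physX hε hε2 hs0 hs1 hn0 hn1
  have h := ((h1.comp (K := 𝓘(ℝ, (ℝ × ℝ) × (ℝ × ℝ))) (P := (ℝ × ℝ) × (ℝ × ℝ)) h2).comp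
    (K := 𝓘(ℝ, ℝ × ℝ × ℝ × ℝ)) (P := ℝ × ℝ × ℝ × ℝ) h3).comp (K := 𝓘(ℝ, 𝔼 4)) (P := (fishNu hε hε2).Surgered) h4
  exact isLocalDiffeomorphAt_congr_nhds' h (Eventually.of_forall fun q' ↦ pieceU3_eq hε hε2 q')

/-- **U4 is a local diffeomorphism** at `(y, ϑ, a, b)` with `2ρ_A < y`, `|a| < ρ_A`, `‖P‖ < t_j`. [folklore] -/
theorem isLocalDiffeomorphAt_pieceU4 {q : ℝ × ℝ × ℝ × ℝ}
    (hy : 2 * ρA < q.1) (ha : |q.2.2.1| < ρA) (hP : ‖(tubeUpMap ρA q).1‖ < capTj ε nj) :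
    IsLocalDiffeomorphAt 𝓘(ℝ, ℝ × ℝ × ℝ × ℝ) 𝓘(ℝ, 𝔼 4) ∞ (pieceU4 hε hε2 nj ρA) q := by
  have h1 := isLocalDiffeomorphAt_tubeUpMap (ρ := ρA) (by linarith [abs_nonneg q.2.2.1]) hy ha
  have h2 := isLocalDiffeomorphAt_dchartX hε hε2 (nj := nj) (q := tubeUpMap ρA q) (capD0_add_mem_slitPlane hP)
  exact h1.comp (K := 𝓘(ℝ, 𝔼 4)) (P := (fishNu hε hε2).Surgered) h2

/-- **U5 is a local diffeomorphism** at `(ψ, ϑ, a, b)` with `-π/4 ≤ ψ ≤ π - arctan (1/3)`, `|a| < δ_J`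
(the Jacobian radius of the unified shell), `0 < X`, `‖P‖ < t_j`. [folklore] -/
theorem isLocalDiffeomorphAt_pieceU5 (hρ : 0 < ρA) {δJ : ℝ}
    (hJ : ∀ q : ℝ × ℝ, -(π / 4) ≤ q.1 → q.1 ≤ π - Real.arctan (1 / 3) → |q.2| < δJ →
      ∃ u v : ℝ × ℝ, HasDerivAt (fun x ↦ pathShell ρA (x, q.2)) u q.1 ∧ HasDerivAt (fun a ↦ pathShell ρA (q.1, a)) v q.2 ∧
        u.1 * v.2 - u.2 * v.1 ≠ 0)
    {q : ℝ × ℝ × ℝ × ℝ} (hψ1 : -(π / 4) ≤ q.1) (hψ2 : q.1 ≤ π - Real.arctan (1 / 3)) (ha : |q.2.2.1| < δJ)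
    (hX : 0 < (pathShell ρA (q.1, q.2.2.1)).1) (hP : ‖(shellTubeMap (pathShell ρA) q).1‖ < capTj ε nj) :
    IsLocalDiffeomorphAt 𝓘(ℝ, ℝ × ℝ × ℝ × ℝ) 𝓘(ℝ, 𝔼 4) ∞ (pieceU5 hε hε2 nj ρA) q := by
  have hπ := Real.pi_pos
  have hA3 : 0 < Real.arctan (1 / 3) := Real.arctan_pos.2 (by norm_num)
  set U : Set (ℝ × ℝ) := {p | -(π / 2) < p.1 ∧ p.1 < π} with hU
  have hUo : IsOpen U := (isOpen_lt continuous_const continuous_fst).and (isOpen_lt continuous_fst continuous_const)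
  have hF : ContDiffOn ℝ ∞ (pathShell ρA) U := fun p hp ↦ (contDiffAt_pathShell hρ hp.1 hp.2).contDiffWithinAt
  obtain ⟨u, v, hu, hv, hD⟩ := hJ (q.1, q.2.2.1) hψ1 hψ2 ha
  have h1 := isLocalDiffeomorphAt_shellTube (F := pathShell ρA) hUo hF (q := q) ⟨by simp only; linarith, by simp only; linarith⟩
    hu hv hD hX.ne'
  have h2 := isLocalDiffeomorphAt_dchartX hε hε2 (nj := nj) (q := shellTubeMap (pathShell ρA) q) (capD0_add_mem_slitPlane hP)
  exact h1.comp (K := 𝓘(ℝ, 𝔼 4)) (P := (fishNu hε hε2).Surgered) h2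

/-- **U2 is a local diffeomorphism** at `(ψ, ℓ, a, b)` with `-π/4 ≤ ψ ≤ π - arctan (1/3)`,
`|ã| < δ_J` (`ã = (rotAB ℓ a b).1`), the image base `t ∈ (0, 3/2)` and latitude `n ≠ 0`, `|n| < 2π`. [folklore] -/
theorem isLocalDiffeomorphAt_pieceU2 (hR : 0 < R₀) {δJ : ℝ}
    (hJ : ∀ q : ℝ × ℝ, -(π / 4) ≤ q.1 → q.1 ≤ π - Real.arctan (1 / 3) → |q.2| < δJ →
      ∃ u v : ℝ × ℝ, HasDerivAt (fun x ↦ pathShell R₀ (x, q.2)) u q.1 ∧ HasDerivAt (fun a ↦ pathShell R₀ (q.1, a)) v q.2 ∧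
        u.1 * v.2 - u.2 * v.1 ≠ 0)
    {q : ℝ × ℝ × ℝ × ℝ} (hψ1 : -(π / 4) ≤ q.1) (hψ2 : q.1 ≤ π - Real.arctan (1 / 3)) (ha : |(rotAB q.2.1 q.2.2.1 q.2.2.2).1| < δJ)
    (ht0 : 0 < (pathTubeMap (pathShell R₀) nj yh t₀ q).2.2.2) (ht1 : (pathTubeMap (pathShell R₀) nj yh t₀ q).2.2.2 < 3 / 2)
    (hn0 : (pathTubeMap (pathShell R₀) nj yh t₀ q).1 ≠ 0) (hn1 : |(pathTubeMap (pathShell R₀) nj yh t₀ q).1| < 2 * π) :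
    IsLocalDiffeomorphAt 𝓘(ℝ, ℝ × ℝ × ℝ × ℝ) 𝓘(ℝ, 𝔼 4) ∞ (pieceU2 hε hε2 nj R₀ yh t₀) q := by
  have hπ := Real.pi_pos
  have hA3 : 0 < Real.arctan (1 / 3) := Real.arctan_pos.2 (by norm_num)
  set U : Set (ℝ × ℝ) := {p | -(π / 2) < p.1 ∧ p.1 < π} with hU
  have hUo : IsOpen U := (isOpen_lt continuous_const continuous_fst).and (isOpen_lt continuous_fst continuous_const)
  have hF : ContDiffOn ℝ ∞ (pathShell R₀) U := fun p hp ↦ (contDiffAt_pathShell hR hp.1 hp.2).contDiffWithinAt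
  obtain ⟨u, v, hu, hv, hD⟩ := hJ (q.1, (rotAB q.2.1 q.2.2.1 q.2.2.2).1) hψ1 hψ2 ha
  have h1 := isLocalDiffeomorphAt_pathTubeMap (F := pathShell R₀) (nj := nj) (yh := yh) (t₀ := t₀) hUo hF (q := q)
    ⟨by simp only; linarith, by simp only; linarith⟩ hu hv hD
  have h2 : IsLocalDiffeomorphAt 𝓘(ℝ, ℝ × ℝ × ℝ × ℝ) 𝓘(ℝ, 𝔼 4) ∞ (physX hε hε2) (pathTubeMap (pathShell R₀) nj yh t₀ q) :=
    isLocalDiffeomorphAt_physX hε hε2 ht0 ht1 hn0 hn1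
  exact h1.comp (K := 𝓘(ℝ, 𝔼 4)) (P := (fishNu hε hε2).Surgered) h2

/-- **U1 is a local diffeomorphism** at `(r, ϑ, a, b)` with `w ≠ 0`, nonvanishing `r`-derivative of
the position, the image base `t ∈ (0, 3/2)` and latitude `n ≠ 0`, `|n| < 2π`. [folklore] -/
theorem isLocalDiffeomorphAt_pieceU1 (hμ : ContDiff ℝ ∞ μL) {q : ℝ × ℝ × ℝ × ℝ} (hw : q.2.2.1 ^ 2 + q.2.2.2 ^ 2 ≠ 0)
    (hder : bxH * (1 + 2 * cL * (ρb - Real.sqrt (q.2.2.1 ^ 2 + q.2.2.2 ^ 2)) * deriv μL q.1) ≠ 0)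
    (ht0 : 0 < (legTubeMap μL cL ρb nj yh q).2.2.2) (ht1 : (legTubeMap μL cL ρb nj yh q).2.2.2 < 3 / 2)
    (hn0 : (legTubeMap μL cL ρb nj yh q).1 ≠ 0) (hn1 : |(legTubeMap μL cL ρb nj yh q).1| < 2 * π) :
    IsLocalDiffeomorphAt 𝓘(ℝ, ℝ × ℝ × ℝ × ℝ) 𝓘(ℝ, 𝔼 4) ∞ (pieceU1 hε hε2 nj yh cL ρb μL) q := by
  have h1 := isLocalDiffeomorphAt_legTubeMap (μ := μL) (c := cL) (ρb := ρb) (nj := nj) (yh := yh) hμ hw hder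
  have h2 : IsLocalDiffeomorphAt 𝓘(ℝ, ℝ × ℝ × ℝ × ℝ) 𝓘(ℝ, 𝔼 4) ∞ (physX hε hε2) (legTubeMap μL cL ρb nj yh q) :=
    isLocalDiffeomorphAt_physX hε hε2 ht0 ht1 hn0 hn1
  exact h1.comp (K := 𝓘(ℝ, 𝔼 4)) (P := (fishNu hε hε2).Surgered) h2

end Pieces

end Literature.Topology.FourManifolds
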